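import Literature.Topology.FourManifolds.FishtailZoneSouth
import Literature.Topology.FourManifolds.FishtailZoneNorthNS
import Literature.Topology.FourManifolds.FishtailBaseCharts
import HarnessLib

/-!
# The zone maps of the tube over the part `D⁰` of Gompf's disc, angular form

Infrastructure for the explicit fishtail neighbourhood (R. Gompf, *More Cappell–Shaneson spheres
are standard*, Algebr. Geom. Topol. 10 (2010), proof of Thm 2.1 and Lemma 2.2; the named fact
`Literature.Topology.FourManifolds.gompf2010_framedTwist`). The part `D⁰` of Gompf's disc lies in
the surgered section sphere; the tube about it is assembled from zone maps
`(n, ϑ, a, b) ↦ X`, latitude (or sphere radius) `n`, base angle `ϑ ∈ ℝ`, offset `(a, b)`: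

* north end (axis `{(e^{in}, 1, 1)}`, `n < 0`): `zoneN2` (rescaling `scaleRealN`), `zoneN3`
  (frame switch `switchXRealN`), `zoneN4` (the tube of the north chart `northNS`, around the
  puncture);
* the flat annulus: `zoneM` (`midT3`, with the winding section);
* south end: `zoneS3` (`switchXReal`), `zoneS2` (`scaleReal`).

Each is the two-chart map (`FishtailBaseCharts.lean`) of a latitude–base map that is `1`-periodic
in the base at the monodromy `tubeShearDiffeo` (`mtCoord_add_one_tubeShear`: the tube shear
fixes points of latitude argument `≤ 1`; `tubeShear_midT3` on the winding annulus), hence a local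
diffeomorphism wherever the underlying real piece is (`isLocalDiffeomorphAt_zone*`), and
`2π`-periodic in `ϑ`. Everything is proved; no named facts.

## References

* R. E. Gompf, *More Cappell–Shaneson spheres are standard*, Algebr. Geom. Topol. 10 (2010)
  1665–1681, proof of Thm 2.1 and Lemma 2.2. [GompfAGT2010]
-/

noncomputable section

open scoped Real ContDiff Topology Manifold
open Set Function Filter Complex

namespace Literature.Topology.FourManifolds

local notation "𝔼" n => EuclideanSpace ℝ (Fin n)
local notation "𝓣" =>
  (ModelWithCorners.prod (𝓡 1) (ModelWithCorners.prod (𝓡 1) (𝓡 1)))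

/-! ### Periodicity of the exponential coordinates at the tube shear -/

section Periodic

/-- **`[expT v, s + 1] = [expT v, s]` at the tube shear** when the latitude argument
`v₀ + v₂ ∈ (-π, 1]` (`F(e^{i(v₀+v₂)}) = 1`), `s ∈ (0, 1/2)`. [folklore] -/
theorem mtCoord_add_one_tubeShear {v : 𝔼 3} (h1 : -π < v 0 + v 2) (h2 : v 0 + v 2 ≤ 1) {s : ℝ} (hs : 0 < s ∧ s < 1 / 2) :
    mtCoord tubeShearDiffeo (v, s + 1) = mtCoord tubeShearDiffeo (v, s) := by
  simp only [mtCoord]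
  refine mtPt_add_one_of_fix ?_ hs
  show tubeShear (expT v) = expT v
  refine tubeShear_eq_self_of_arg_le_one ?_
  have hprod : ((expT v).1 * (expT v).2.2 : Circle) = Circle.exp (v 0 + v 2) := by
    simp [expT, Circle.exp_add]
  rw [hprod, Circle.arg_exp h1 (by linarith [Real.pi_gt_three])]
  exact h2

/-- A bound `|v₀ + v₂| ≤ 1` suffices. [folklore] -/
theorem mtCoord_add_one_tubeShear' {v : 𝔼 3} (h : |v 0 + v 2| ≤ 1) {s : ℝ} (hs : 0 < s ∧ s < 1 / 2) :
    mtCoord tubeShearDiffeo (v, s + 1) = mtCoord tubeShearDiffeo (v, s) :=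
  mtCoord_add_one_tubeShear (by linarith [(abs_le.1 h).1, Real.pi_gt_three]) (abs_le.1 h).2 hs

end Periodic

/-! ### The sign change of the latitude -/

section NegN

/-- `(n, s, a, b) ↦ (-n, s, a, b)`, a diffeomorphism. [folklore] -/
def negN : (ℝ × ℝ × ℝ × ℝ) ≃ₘ⟮𝓘(ℝ, ℝ × ℝ × ℝ × ℝ), 𝓘(ℝ, ℝ × ℝ × ℝ × ℝ)⟯ (ℝ × ℝ × ℝ × ℝ) where
  toFun q := (-q.1, q.2)
  invFun q := (-q.1, q.2)
  left_inv q := by simp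
  right_inv q := by simp
  contMDiff_toFun := contMDiff_iff_contDiff.2 (contDiff_fst.neg.prodMk contDiff_snd)
  contMDiff_invFun := contMDiff_iff_contDiff.2 (contDiff_fst.neg.prodMk contDiff_snd)

/-- The value of `negN`. [folklore] -/
@[simp] theorem negN_apply (q : ℝ × ℝ × ℝ × ℝ) : negN q = (-q.1, q.2) := rfl

end NegN

/-! ### The zones -/

section Zones

variable (ε tj δ r₁ r₂ r₃ lam c : ℝ) (kapN kapS : ℝ → ℝ) (μN μS : ℝ → ℝ) (kap : ℝ)

/-- **North rescaling zone** (latitude `n = -n₀ < 0`). [folklore] -/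
def zoneN2 : ℝ × ℝ × ℝ × ℝ → MTorus tubeShearDiffeo :=
  twoChart fun p ↦ mtCoord tubeShearDiffeo (scaleRealN kapN (negN p))

/-- **North switch zone.** [folklore] -/
def zoneN3 : ℝ × ℝ × ℝ × ℝ → MTorus tubeShearDiffeo :=
  twoChart fun p ↦ mtCoord tubeShearDiffeo (switchXRealN μN kap (negN p))

/-- **North chart zone** (around the puncture). [folklore] -/
def zoneN4 : ℝ × ℝ × ℝ × ℝ → MTorus tubeShearDiffeo :=
  twoChart (northNS ε tj δ r₁ r₂ r₃ lam tubeShearDiffeo)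

/-- The latitude–base map of the flat annulus. [folklore] -/
def midNS (p : ℝ × ℝ × ℝ × ℝ) : MTorus tubeShearDiffeo :=
  mtPt tubeShearDiffeo (midT3 c δ lam p.1 p.2.1 p.2.2.1 p.2.2.2) p.2.1

/-- **Flat annulus zone** (with the winding section). [folklore] -/
def zoneM : ℝ × ℝ × ℝ × ℝ → MTorus tubeShearDiffeo := twoChart (midNS δ lam c)

/-- **South switch zone** (`n = n₀ > 0`). [folklore] -/
def zoneS3 : ℝ × ℝ × ℝ × ℝ → MTorus tubeShearDiffeo :=
  twoChart fun p ↦ mtCoord tubeShearDiffeo (switchXReal μS kap p)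

/-- **South rescaling zone.** [folklore] -/
def zoneS2 : ℝ × ℝ × ℝ × ℝ → MTorus tubeShearDiffeo :=
  twoChart fun p ↦ mtCoord tubeShearDiffeo (scaleReal kapS p)

variable {ε tj δ r₁ r₂ r₃ lam c kapN kapS μN μS kap}

/-! #### Latitude-argument bounds of the real pieces -/

/-- South rescaling: `v₀ ∈ [0, n₀]`, `|v₂| ≤ n₀` under admissibility. [folklore] -/
theorem abs_sum_scaleReal {q : ℝ × ℝ × ℝ × ℝ} (hn : 0 ≤ q.1)
    (h : (kapS q.1 * q.2.2.1) ^ 2 + (kapS q.1 * q.2.2.2) ^ 2 ≤ q.1 ^ 2) :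
    |(scaleReal kapS q).1 0 + (scaleReal kapS q).1 2| ≤ 2 * q.1 := by
  simp only [scaleReal, PiLp.toLp_apply, Matrix.cons_val_zero, Matrix.cons_val]
  have h0 : 0 ≤ sphX q.1 (kapS q.1 * q.2.2.1) (kapS q.1 * q.2.2.2) := Real.sqrt_nonneg _
  have h1 : sphX q.1 (kapS q.1 * q.2.2.1) (kapS q.1 * q.2.2.2) ≤ q.1 := by
    rw [sphX, Real.sqrt_le_left hn]; nlinarith
  have h2 : |kapS q.1 * q.2.2.2| ≤ q.1 := by
    rw [← Real.sqrt_sq_eq_abs]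
    calc Real.sqrt ((kapS q.1 * q.2.2.2) ^ 2) ≤ Real.sqrt (q.1 ^ 2) := Real.sqrt_le_sqrt (by nlinarith)
      _ = q.1 := Real.sqrt_sq hn
  have := neg_abs_le (kapS q.1 * q.2.2.2)
  have := le_abs_self (kapS q.1 * q.2.2.2)
  rw [abs_le]; constructor <;> simp <;> linarith

/-- North rescaling: the same bound. [folklore] -/
theorem abs_sum_scaleRealN {q : ℝ × ℝ × ℝ × ℝ} (hn : 0 ≤ q.1)
    (h : (kapN q.1 * q.2.2.1) ^ 2 + (kapN q.1 * q.2.2.2) ^ 2 ≤ q.1 ^ 2) :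
    |(scaleRealN kapN q).1 0 + (scaleRealN kapN q).1 2| ≤ 2 * q.1 := by
  have h' := abs_sum_scaleReal (kapS := kapN) (q := negB q) hn (by simpa using h)
  rw [scaleRealN, mirrorL_apply]
  simp only [Matrix.cons_val_zero, Matrix.cons_val]
  rw [show -(scaleReal kapN (negB q)).1 0 + -(scaleReal kapN (negB q)).1 2 =
    -((scaleReal kapN (negB q)).1 0 + (scaleReal kapN (negB q)).1 2) by ring, abs_neg]
  simpa using h'

/-- South switch: `|v₀ + v₂| ≤ n₀ + 2|κ b|` for `0 ≤ μ ≤ 1`, `0 ≤ n₀`. [folklore] -/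
theorem abs_sum_switchXReal {q : ℝ × ℝ × ℝ × ℝ} (hn : 0 ≤ q.1) (hμ0 : 0 ≤ μS q.1) (hμ1 : μS q.1 ≤ 1) :
    |(switchXReal μS kap q).1 0 + (switchXReal μS kap q).1 2| ≤ q.1 + 2 * |kap * q.2.2.2| := by
  have e0 : (switchXReal μS kap q).1 0 = switchX μS kap q.1 q.2.2.1 q.2.2.2 := rfl
  have e2 : (switchXReal μS kap q).1 2 = -(kap * q.2.2.2) := rfl
  rw [e0, e2, switchX]
  set S := sphX q.1 (kap * q.2.2.1) (kap * q.2.2.2) with hS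
  set B := |kap * q.2.2.2| with hB
  have h0 : 0 ≤ S := Real.sqrt_nonneg _
  have h1 : S ≤ q.1 := by rw [hS, sphX, Real.sqrt_le_left hn]; nlinarith
  have hb := neg_abs_le (kap * q.2.2.2)
  have hb' := le_abs_self (kap * q.2.2.2)
  have hB0 : 0 ≤ B := abs_nonneg _
  have p1 : 0 ≤ (1 - μS q.1) * S := mul_nonneg (by linarith) h0
  have p2 : (1 - μS q.1) * S ≤ (1 - μS q.1) * q.1 := mul_le_mul_of_nonneg_left h1 (by linarith)
  have p3 : μS q.1 * (q.1 + kap * q.2.2.2) ≤ μS q.1 * (q.1 + B) := mul_le_mul_of_nonneg_left (by linarith) hμ0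
  have p4 : μS q.1 * -B ≤ μS q.1 * (q.1 + kap * q.2.2.2) := mul_le_mul_of_nonneg_left (by linarith) hμ0
  have p5 : μS q.1 * B ≤ B := by nlinarith
  rw [abs_le]; constructor <;> nlinarith

/-- North switch: the same bound (the statement is about `|κ (-b)| = |κ b|`). [folklore] -/
theorem abs_sum_switchXRealN {q : ℝ × ℝ × ℝ × ℝ} (hn : 0 ≤ q.1) (hμ0 : 0 ≤ μN q.1) (hμ1 : μN q.1 ≤ 1) :
    |(switchXRealN μN kap q).1 0 + (switchXRealN μN kap q).1 2| ≤ q.1 + 2 * |kap * q.2.2.2| := by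
  have h' := abs_sum_switchXReal (μS := μN) (kap := kap) (q := negB q) hn hμ0 hμ1
  rw [switchXRealN, mirrorL_apply]
  simp only [Matrix.cons_val_zero, Matrix.cons_val]
  rw [show -(switchXReal μN kap (negB q)).1 0 + -(switchXReal μN kap (negB q)).1 2 =
    -((switchXReal μN kap (negB q)).1 0 + (switchXReal μN kap (negB q)).1 2) by ring, abs_neg]
  simpa using h'

/-! #### Periodicity of the latitude–base maps -/

/-- Periodicity of the flat-annulus map (the seam condition). [folklore] -/
theorem midNS_add_one (hc1 : -π < c) (hc2 : c < 1) (hδ : 0 < δ) (hδ' : δ ≤ 1 / 4) (n s : ℝ) (w : ℝ × ℝ)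
    (hs0 : 0 < s) (hs1 : s < 1 / 2) : midNS δ lam c (n, s + 1, w) = midNS δ lam c (n, s, w) := by
  simp only [midNS]
  rw [← tubeShear_midT3 hc1 hc2 hδ (by linarith) (by linarith) n w.1 w.2]
  exact mtPt_apply_add_one _ ⟨hs0, hs1⟩

/-- Periodicity of the north chart map. [folklore] -/
theorem northNS_add_one' (hε : 0 < ε) (hεπ : ε < π) (n s : ℝ) (w : ℝ × ℝ) (hs0 : 0 < s) (hs1 : s < 1 / 2) :
    northNS ε tj δ r₁ r₂ r₃ lam tubeShearDiffeo (n, s + 1, w) = northNS ε tj δ r₁ r₂ r₃ lam tubeShearDiffeo (n, s, w) :=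
  northNS_add_one (fun d a b ↦ tubeShear_northT3 hε hεπ d a b) n ⟨hs0, hs1⟩ w.1 w.2

/-! #### Local diffeomorphism properties -/

/-- **The flat-annulus zone is a local diffeomorphism** at `(n, ϑ, a, b)` when `λ ≠ 0` and the
real section `σ₀` is smooth near `(n, s)` for all `s`. [folklore] -/
theorem isLocalDiffeomorphAt_zoneM (hc1 : -π < c) (hc2 : c < 1) (hδ : 0 < δ) (hδ' : δ ≤ 1 / 4) (hlam : lam ≠ 0)
    {q : ℝ × ℝ × ℝ × ℝ}
    (hσ : ∀ s : ℝ, ∀ᶠ p in 𝓝 (q.1, s), ContDiffAt ℝ ∞ (fun p : ℝ × ℝ ↦ sigmaFar c δ (Circle.exp p.1) p.2) p) :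
    IsLocalDiffeomorphAt 𝓘(ℝ, ℝ × ℝ × ℝ × ℝ) 𝓘(ℝ, 𝔼 4) ∞ (zoneM δ lam c) q := by
  refine isLocalDiffeomorphAt_twoChart (fun n s w h0 h1 ↦ midNS_add_one hc1 hc2 hδ hδ' n s w h0 h1) fun s h0 h1 ↦ ?_
  exact isLocalDiffeomorphAt_mtPt_midTube tubeShearDiffeo hlam (q := (q.1, s, q.2.2)) h0 h1 (hσ s)

/-- **The north chart zone is a local diffeomorphism** at `(n, ϑ, a, b)`, `n² < ε²`, `n < 0`,
`λ ≠ 0`, `ε < π`, when the section is smooth near the chart points `capPt ε n (ϑ/(2π) + c)`,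
`c ∈ ℤ`, with base value in `(0, 3/2)`. [folklore] -/
theorem isLocalDiffeomorphAt_zoneN4 (hε : 0 < ε) (hεπ : ε < π) (hlam : lam ≠ 0) {q : ℝ × ℝ × ℝ × ℝ}
    (hn : q.1 ^ 2 < ε ^ 2) (hn0 : q.1 < 0)
    (hσ : ∀ c : ℤ, 0 < q.2.1 / (2 * π) + c → q.2.1 / (2 * π) + c < 3 / 2 →
      ∀ᶠ d in 𝓝 (capPt ε q.1 (q.2.1 / (2 * π) + c)), ContMDiffAt 𝓘(ℝ, ℂ) (𝓡 1) ∞ (sigmaCapC tj δ r₁ r₂ r₃) d) :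
    IsLocalDiffeomorphAt 𝓘(ℝ, ℝ × ℝ × ℝ × ℝ) 𝓘(ℝ, 𝔼 4) ∞ (zoneN4 ε tj δ r₁ r₂ r₃ lam) q := by
  refine isLocalDiffeomorphAt_twoChart' (fun n s w h0 h1 ↦ northNS_add_one' hε hεπ n s w h0 h1) fun k h0 h1 ↦ ?_
  exact isLocalDiffeomorphAt_northNS (ψ := tubeShearDiffeo) hε hlam (q := (q.1, q.2.1 / (2 * π) + k, q.2.2))
    hn hn0 h0 h1 (hσ k h0 h1)

/-- Openness of the strict admissibility region `{(n, w) | 0 < n < N, (κ(n) w₁)² + (κ(n) w₂)² < n²}`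
for continuous `κ`. [folklore] -/
theorem isOpen_admissible {kap' : ℝ → ℝ} (hk : Continuous kap') (N : ℝ) :
    IsOpen {p : ℝ × (ℝ × ℝ) | 0 < p.1 ∧ p.1 < N ∧ (kap' p.1 * p.2.1) ^ 2 + (kap' p.1 * p.2.2) ^ 2 < p.1 ^ 2} := by
  refine (isOpen_lt continuous_const continuous_fst).and ((isOpen_lt continuous_fst continuous_const).and ?_)
  have hk1 : Continuous fun p : ℝ × (ℝ × ℝ) ↦ kap' p.1 := hk.comp continuous_fst
  exact isOpen_lt (((hk1.mul (continuous_fst.comp continuous_snd)).pow 2).add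
    ((hk1.mul (continuous_snd.comp continuous_snd)).pow 2)) (continuous_fst.pow 2)

/-- **The south rescaling zone is a local diffeomorphism** at `(n₀, ϑ, a, b)`, `0 < n₀ < 1/2`,
`κ` smooth, `κ(n₀) ≠ 0`, strictly admissible offsets. [folklore] -/
theorem isLocalDiffeomorphAt_zoneS2 (hkap : ContDiff ℝ ∞ kapS) {q : ℝ × ℝ × ℝ × ℝ} (hn : 0 < q.1) (hn1 : q.1 < 1 / 2)
    (hk : kapS q.1 ≠ 0) (h : (kapS q.1 * q.2.2.1) ^ 2 + (kapS q.1 * q.2.2.2) ^ 2 < q.1 ^ 2) :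
    IsLocalDiffeomorphAt 𝓘(ℝ, ℝ × ℝ × ℝ × ℝ) 𝓘(ℝ, 𝔼 4) ∞ (zoneS2 kapS) q := by
  refine isLocalDiffeomorphAt_twoChart_loc ?_ fun k h0 h1 ↦ ?_
  · have hmem : (q.1, q.2.2) ∈ {p : ℝ × (ℝ × ℝ) | 0 < p.1 ∧ p.1 < 1 / 2 ∧
        (kapS p.1 * p.2.1) ^ 2 + (kapS p.1 * p.2.2) ^ 2 < p.1 ^ 2} := ⟨hn, hn1, h⟩
    filter_upwards [(isOpen_admissible hkap.continuous (1 / 2)).mem_nhds hmem] with p hp s h0 h1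
    have hb := abs_sum_scaleReal (kapS := kapS) (q := (p.1, s, p.2)) hp.1.le hp.2.2.le
    show mtCoord tubeShearDiffeo (scaleReal kapS (p.1, s + 1, p.2)) = mtCoord tubeShearDiffeo (scaleReal kapS (p.1, s, p.2))
    rw [show scaleReal kapS (p.1, s + 1, p.2) = ((scaleReal kapS (p.1, s, p.2)).1, s + 1) from rfl,
      show scaleReal kapS (p.1, s, p.2) = ((scaleReal kapS (p.1, s, p.2)).1, s) from rfl]
    exact mtCoord_add_one_tubeShear' (by simp only at hb ⊢; linarith [hp.2.1]) ⟨h0, h1⟩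
  · exact isLocalDiffeomorphAt_mtCoord_scaleReal tubeShearDiffeo hkap (q := (q.1, q.2.1 / (2 * π) + k, q.2.2)) hn hk h h0 h1

/-- **The north rescaling zone is a local diffeomorphism** at `(n, ϑ, a, b)`, `n = -n₀`,
`0 < n₀ < 1/2`, `κ` smooth, `κ(n₀) ≠ 0`, strictly admissible offsets. [folklore] -/
theorem isLocalDiffeomorphAt_zoneN2 (hkap : ContDiff ℝ ∞ kapN) {q : ℝ × ℝ × ℝ × ℝ} (hn : 0 < -q.1) (hn1 : -q.1 < 1 / 2)
    (hk : kapN (-q.1) ≠ 0) (h : (kapN (-q.1) * q.2.2.1) ^ 2 + (kapN (-q.1) * q.2.2.2) ^ 2 < (-q.1) ^ 2) :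
    IsLocalDiffeomorphAt 𝓘(ℝ, ℝ × ℝ × ℝ × ℝ) 𝓘(ℝ, 𝔼 4) ∞ (zoneN2 kapN) q := by
  refine isLocalDiffeomorphAt_twoChart_loc ?_ fun k h0 h1 ↦ ?_
  · have hmem : (-q.1, q.2.2) ∈ {p : ℝ × (ℝ × ℝ) | 0 < p.1 ∧ p.1 < 1 / 2 ∧
        (kapN p.1 * p.2.1) ^ 2 + (kapN p.1 * p.2.2) ^ 2 < p.1 ^ 2} := ⟨hn, hn1, h⟩
    have hc : ContinuousAt (fun p : ℝ × (ℝ × ℝ) ↦ (-p.1, p.2)) (q.1, q.2.2) := (continuous_fst.neg.prodMk continuous_snd).continuousAt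
    have hev := hc.preimage_mem_nhds ((isOpen_admissible hkap.continuous (1 / 2)).mem_nhds hmem)
    filter_upwards [hev] with p hp s h0 h1
    have hp' : 0 < -p.1 ∧ -p.1 < 1 / 2 ∧ (kapN (-p.1) * p.2.1) ^ 2 + (kapN (-p.1) * p.2.2) ^ 2 < (-p.1) ^ 2 := hp
    have hb := abs_sum_scaleRealN (kapN := kapN) (q := (-p.1, s, p.2)) hp'.1.le hp'.2.2.le
    show mtCoord tubeShearDiffeo (scaleRealN kapN (negN (p.1, s + 1, p.2))) =
      mtCoord tubeShearDiffeo (scaleRealN kapN (negN (p.1, s, p.2)))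
    simp only [negN_apply]
    rw [show scaleRealN kapN (-p.1, s + 1, p.2) = ((scaleRealN kapN (-p.1, s, p.2)).1, s + 1) from rfl,
      show scaleRealN kapN (-p.1, s, p.2) = ((scaleRealN kapN (-p.1, s, p.2)).1, s) from rfl]
    exact mtCoord_add_one_tubeShear' (by simp only at hb ⊢; linarith [hp'.2.1]) ⟨h0, h1⟩
  · have h1' : IsLocalDiffeomorphAt 𝓘(ℝ, ℝ × ℝ × ℝ × ℝ) 𝓘(ℝ, ℝ × ℝ × ℝ × ℝ) ∞ negN (q.1, q.2.1 / (2 * π) + k, q.2.2) :=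
      negN.isLocalDiffeomorph _
    have h2 := isLocalDiffeomorphAt_mtCoord_scaleRealN tubeShearDiffeo hkap (q := (-q.1, q.2.1 / (2 * π) + k, q.2.2))
      hn hk h h0 h1
    exact h1'.comp (K := 𝓘(ℝ, 𝔼 4)) (P := MTorus tubeShearDiffeo) h2

/-- Openness of the switch region `{(n, w) | 0 < n < N, (κ w₁)² + (κ w₂)² < n², |κ w₂| < B}`. [folklore] -/
theorem isOpen_switchRegion (kap N B : ℝ) :
    IsOpen {p : ℝ × (ℝ × ℝ) | 0 < p.1 ∧ p.1 < N ∧ (kap * p.2.1) ^ 2 + (kap * p.2.2) ^ 2 < p.1 ^ 2 ∧ |kap * p.2.2| < B} := by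
  refine (isOpen_lt continuous_const continuous_fst).and ((isOpen_lt continuous_fst continuous_const).and
    ((isOpen_lt ?_ (continuous_fst.pow 2)).and (isOpen_lt ?_ continuous_const)))
  · exact ((continuous_const.mul (continuous_fst.comp continuous_snd)).pow 2).add
      ((continuous_const.mul (continuous_snd.comp continuous_snd)).pow 2)
  · exact continuous_abs.comp (continuous_const.mul (continuous_snd.comp continuous_snd))

/-- **The south switch zone is a local diffeomorphism** at `(n₀, ϑ, a, b)`: `0 < n₀ < 1/2`,
`0 ≤ μ ≤ 1`, `κ ≠ 0`, strictly admissible offsets with `|κ b| < 1/4`, and nonvanishing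
`n₀`-derivative of the abscissa. [folklore] -/
theorem isLocalDiffeomorphAt_zoneS3 (hμ : ContDiff ℝ ∞ μS) (hμ01 : ∀ n, 0 ≤ μS n ∧ μS n ≤ 1) (hk : kap ≠ 0)
    {q : ℝ × ℝ × ℝ × ℝ} (hn : 0 < q.1) (hn1 : q.1 < 1 / 2)
    (h : (kap * q.2.2.1) ^ 2 + (kap * q.2.2.2) ^ 2 < q.1 ^ 2) (hb : |kap * q.2.2.2| < 1 / 4)
    (hder : -deriv μS q.1 * sphX q.1 (kap * q.2.2.1) (kap * q.2.2.2) +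
        (1 - μS q.1) * (q.1 / Real.sqrt (q.1 ^ 2 - (kap * q.2.2.1) ^ 2 - (kap * q.2.2.2) ^ 2)) +
        (deriv μS q.1 * (q.1 + kap * q.2.2.2) + μS q.1 * 1) ≠ 0) :
    IsLocalDiffeomorphAt 𝓘(ℝ, ℝ × ℝ × ℝ × ℝ) 𝓘(ℝ, 𝔼 4) ∞ (zoneS3 μS kap) q := by
  refine isLocalDiffeomorphAt_twoChart_loc ?_ fun k h0 h1 ↦ ?_
  · have hmem : (q.1, q.2.2) ∈ {p : ℝ × (ℝ × ℝ) | 0 < p.1 ∧ p.1 < 1 / 2 ∧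
        (kap * p.2.1) ^ 2 + (kap * p.2.2) ^ 2 < p.1 ^ 2 ∧ |kap * p.2.2| < 1 / 4} := ⟨hn, hn1, h, hb⟩
    filter_upwards [(isOpen_switchRegion kap (1 / 2) (1 / 4)).mem_nhds hmem] with p hp s h0 h1
    have hbd := abs_sum_switchXReal (μS := μS) (kap := kap) (q := (p.1, s, p.2)) hp.1.le (hμ01 p.1).1 (hμ01 p.1).2
    show mtCoord tubeShearDiffeo (switchXReal μS kap (p.1, s + 1, p.2)) = mtCoord tubeShearDiffeo (switchXReal μS kap (p.1, s, p.2))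
    rw [show switchXReal μS kap (p.1, s + 1, p.2) = ((switchXReal μS kap (p.1, s, p.2)).1, s + 1) from rfl,
      show switchXReal μS kap (p.1, s, p.2) = ((switchXReal μS kap (p.1, s, p.2)).1, s) from rfl]
    exact mtCoord_add_one_tubeShear' (by simp only at hbd ⊢; linarith [hp.2.1, hp.2.2.2]) ⟨h0, h1⟩
  · exact isLocalDiffeomorphAt_mtCoord_switchXReal tubeShearDiffeo hμ hk (q := (q.1, q.2.1 / (2 * π) + k, q.2.2)) h hder h0 h1

/-- **The north switch zone is a local diffeomorphism** at `(n, ϑ, a, b)`, `n = -n₀`, under the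
mirrored hypotheses (at `(n₀, ·, a, -b)`). [folklore] -/
theorem isLocalDiffeomorphAt_zoneN3 (hμ : ContDiff ℝ ∞ μN) (hμ01 : ∀ n, 0 ≤ μN n ∧ μN n ≤ 1) (hk : kap ≠ 0)
    {q : ℝ × ℝ × ℝ × ℝ} (hn : 0 < -q.1) (hn1 : -q.1 < 1 / 2)
    (h : (kap * q.2.2.1) ^ 2 + (kap * q.2.2.2) ^ 2 < (-q.1) ^ 2) (hb : |kap * q.2.2.2| < 1 / 4)
    (hder : -deriv μN (-q.1) * sphX (-q.1) (kap * q.2.2.1) (kap * -q.2.2.2) +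
        (1 - μN (-q.1)) * ((-q.1) / Real.sqrt ((-q.1) ^ 2 - (kap * q.2.2.1) ^ 2 - (kap * -q.2.2.2) ^ 2)) +
        (deriv μN (-q.1) * ((-q.1) + kap * -q.2.2.2) + μN (-q.1) * 1) ≠ 0) :
    IsLocalDiffeomorphAt 𝓘(ℝ, ℝ × ℝ × ℝ × ℝ) 𝓘(ℝ, 𝔼 4) ∞ (zoneN3 μN kap) q := by
  refine isLocalDiffeomorphAt_twoChart_loc ?_ fun k h0 h1 ↦ ?_
  · have hmem : (-q.1, q.2.2) ∈ {p : ℝ × (ℝ × ℝ) | 0 < p.1 ∧ p.1 < 1 / 2 ∧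
        (kap * p.2.1) ^ 2 + (kap * p.2.2) ^ 2 < p.1 ^ 2 ∧ |kap * p.2.2| < 1 / 4} := ⟨hn, hn1, h, hb⟩
    have hc : ContinuousAt (fun p : ℝ × (ℝ × ℝ) ↦ (-p.1, p.2)) (q.1, q.2.2) := (continuous_fst.neg.prodMk continuous_snd).continuousAt
    have hev := hc.preimage_mem_nhds ((isOpen_switchRegion kap (1 / 2) (1 / 4)).mem_nhds hmem)
    filter_upwards [hev] with p hp s h0 h1
    have hp' : 0 < -p.1 ∧ -p.1 < 1 / 2 ∧ (kap * p.2.1) ^ 2 + (kap * p.2.2) ^ 2 < (-p.1) ^ 2 ∧ |kap * p.2.2| < 1 / 4 := hp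
    have hbd := abs_sum_switchXRealN (μN := μN) (kap := kap) (q := (-p.1, s, p.2)) hp'.1.le (hμ01 _).1 (hμ01 _).2
    show mtCoord tubeShearDiffeo (switchXRealN μN kap (negN (p.1, s + 1, p.2))) =
      mtCoord tubeShearDiffeo (switchXRealN μN kap (negN (p.1, s, p.2)))
    simp only [negN_apply]
    rw [show switchXRealN μN kap (-p.1, s + 1, p.2) = ((switchXRealN μN kap (-p.1, s, p.2)).1, s + 1) from rfl,
      show switchXRealN μN kap (-p.1, s, p.2) = ((switchXRealN μN kap (-p.1, s, p.2)).1, s) from rfl]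
    exact mtCoord_add_one_tubeShear' (by simp only at hbd ⊢; linarith [hp'.2.1, hp'.2.2.2]) ⟨h0, h1⟩
  · have h1' : IsLocalDiffeomorphAt 𝓘(ℝ, ℝ × ℝ × ℝ × ℝ) 𝓘(ℝ, ℝ × ℝ × ℝ × ℝ) ∞ negN (q.1, q.2.1 / (2 * π) + k, q.2.2) :=
      negN.isLocalDiffeomorph _
    have h2 := isLocalDiffeomorphAt_mtCoord_switchXRealN tubeShearDiffeo hμ hk
      (q := (-q.1, q.2.1 / (2 * π) + k, q.2.2)) h hder h0 h1
    exact h1'.comp (K := 𝓘(ℝ, 𝔼 4)) (P := MTorus tubeShearDiffeo) h2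

/-! #### Values -/

/-- The zones are `2π`-periodic in the angle. [folklore] -/
theorem zoneM_add_two_pi (q : ℝ × ℝ × ℝ × ℝ) : zoneM δ lam c (q.1, q.2.1 + 2 * π, q.2.2) = zoneM δ lam c q :=
  twoChart_add_two_pi q

/-- The value of the flat-annulus zone. [folklore] -/
theorem zoneM_apply (q : ℝ × ℝ × ℝ × ℝ) : zoneM δ lam c q =
    mtPt tubeShearDiffeo (midT3 c δ lam q.1 (baseOf (exp (q.2.1 * I))) q.2.2.1 q.2.2.2) (baseOf (exp (q.2.1 * I))) := rfl

/-- The value of the north chart zone. [folklore] -/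
theorem zoneN4_apply (q : ℝ × ℝ × ℝ × ℝ) : zoneN4 ε tj δ r₁ r₂ r₃ lam q =
    mtPt tubeShearDiffeo (northT3 ε tj δ r₁ r₂ r₃ lam (capPt ε q.1 (baseOf (exp (q.2.1 * I)))) q.2.2.1 q.2.2.2)
      (baseOf (exp (q.2.1 * I))) := rfl

/-- The value of the south switch zone. [folklore] -/
theorem zoneS3_apply (q : ℝ × ℝ × ℝ × ℝ) : zoneS3 μS kap q =
    mtCoord tubeShearDiffeo (switchXReal μS kap (q.1, baseOf (exp (q.2.1 * I)), q.2.2)) := rfl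

/-- The value of the south rescaling zone. [folklore] -/
theorem zoneS2_apply (q : ℝ × ℝ × ℝ × ℝ) : zoneS2 kapS q =
    mtCoord tubeShearDiffeo (scaleReal kapS (q.1, baseOf (exp (q.2.1 * I)), q.2.2)) := rfl

/-- The value of the north rescaling zone. [folklore] -/
theorem zoneN2_apply (q : ℝ × ℝ × ℝ × ℝ) : zoneN2 kapN q =
    mtCoord tubeShearDiffeo (scaleRealN kapN (-q.1, baseOf (exp (q.2.1 * I)), q.2.2)) := rfl

/-- The value of the north switch zone. [folklore] -/
theorem zoneN3_apply (q : ℝ × ℝ × ℝ × ℝ) : zoneN3 μN kap q =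
    mtCoord tubeShearDiffeo (switchXRealN μN kap (-q.1, baseOf (exp (q.2.1 * I)), q.2.2)) := rfl

end Zones

end Literature.Topology.FourManifolds
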